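import Mathlib
import HarnessLib
import Summits.AtomisticToContinuum.FouriersLaw.Theses.JunctionLocality
import Summits.AtomisticToContinuum.FouriersLaw.Theorems.JunctionLocalitySuperadditiveResistanceStubKappaFrame
import Summits.AtomisticToContinuum.FouriersLaw.Theorems.JunctionLocalitySuperadditiveResistanceTerminationIdentity
import Summits.AtomisticToContinuum.FouriersLaw.Theorems.JunctionLocalitySuperadditiveResistanceStubBypassBoundAux2

/-!
# Bypass-bound helpers IV: the bypass of a κ-resolvent family in GRADIENT FORM
(helpers `--supports` stmt-AtomisticToContinuum-11748 for stub `stub_bypassBound` (S2') of line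
`floating-probe-bypass-laplacian`, skeleton v7, crux `JunctionLocality.SuperadditiveResistance`)

S2' asks, `N`-UNIFORMLY and eventually in `κ → 0⁺`, for `x ≤ C₃ a b` where, for a family `g` of `κ`-resolvent
fields of the four terminals of the γ-probed `(N, M)`-device (`κ g_a − L_dev g_a = p_{s_a}² − T`,
`g a ∈ deviceResolventFields … (termSite N M a) κ`), `x := −K₀₃` is the direct end-to-end transfer coefficient and
`a := K₀₀`, `b := K₃₃` the end self-coefficients of the resolvent Kubo matrix
`K_ab = γδ_ab − (γ²/T²)⟨g_a, p_{s_b}² − T⟩_{μ_T}` (`L = N + M`). This file (part IV; parts V, VI are the companions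
`…StubBypassBoundAux5/6`) proves at FIXED `N, M, κ`, every integrability obligation discharged:

* `memLp_partialP_deviceResolvent` — a resolvent field has a square-integrable momentum gradient at every
  thermostatted site (finite entropy production; the landed energy estimate `Kubo.memLp_partialP` for the pair form
  `deviceResolvent_pair_sq`);
* `bypass_eq_farGradient` — **gradient form** `x = (γ²/T)·⟨∂_{p_{L−1}} g_0, p_{L−1}⟩_{μ_T}` (Gaussian integration by
  parts in the far bath momentum, landed `integral_mul_sq_sub_gibbsMeasure`); by the Onsager symmetry of the resolvent
  frame (`kuboMatrix_symm_resolvent`, the symmetry clause of the landed `kubo_onsager_resolvent`) also the mirror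
  form `x = (γ²/T)·⟨∂_{p_0} g_3, p_0⟩_{μ_T}` (`bypass_eq_nearGradient`);
* `bypass_le_farGradientNorm` — `x ≤ (γ²/T²)·T√T·‖∂_{p_{L−1}} g_0‖_{L²(μ_T)}` (Cauchy–Schwarz and equipartition);
* `partialP_last_sub_comp_restrictLeft`, `bypass_eq_defectGradient` — for EVERY left-block observable `F` the
  κ-defect `u = g_0 − F∘π_N` has the same far gradient as `g_0`, so `x = (γ²/T)·⟨∂_{p_{L−1}} u, p_{L−1}⟩_{μ_T}`: with
  `F = g_N` (a plain forward field of the bare `N`-chain) everything is about the far-momentum gradient of the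
  junction-forced defect (part V: its far PAIRING and the κ-frame far-transmission identity);
* **`helper_bypassBoundOfFarGradientNorm`** (registered) — the registered stub FOLLOWS, constant for constant, from the
  `N`-uniform far-gradient NORM bound `(γ²/T²)·T√T·‖∂_{p_{L−1}} g_0‖_{L²(μ_T)} ≤ C₃ K₀₀ K₃₃` (eventually in `κ`, all
  resolvent families) — a SUFFICIENT condition; part VI shows the free budget is only `‖∂_{p_{L−1}} g_0‖² ≤ (T/γ³) K₀₀`.

Vocabulary: the skeleton's `termSite`, `kuboMatrix`, `termFin` (`…StubKuboOnsager`), `deviceResolventFields`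
(`…StubKappaFrame`); Gaussian IBP / Cauchy–Schwarz from `…StubBypassBoundAux2`; `deviceWeight_nonneg` via
`…TerminationIdentity`. No `N`-uniform estimate is proved here; standard axioms only.
-/

noncomputable section

open MeasureTheory Filter Topology
open scoped ContDiff
open Literature.MathematicalPhysics.KineticTheory.HeatConduction
open Summit.AtomisticToContinuum.FouriersLaw.Theorems.SuperadditiveResistance.DeviceLiouville
  (kin deviceGenerator deviceWeight deviceGenerator_eq kin_eq_sq liouvilleOp bathOp)
open Summit.AtomisticToContinuum.FouriersLaw.Theorems.SuperadditiveResistance.Kubo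
  (rev rev_apply rev_pair memLp_partialP memLp_kinetic termWeight kubo_onsager_resolvent)
open Summit.AtomisticToContinuum.FouriersLaw.Cruxes.SuperadditiveResistance.ThermaliseThenCutProbeInsertion
  (deviceWeight_nonneg)

namespace Summit.AtomisticToContinuum.FouriersLaw.Cruxes.SuperadditiveResistance.FloatingProbeBypassLaplacian

/-! ## §1 Resolvent fields: pair form and square-integrable bath gradients -/

section Resolvent

variable {ω₂ lam β γ T : ℝ} {N M : ℕ}

/-- A site whose index is the far bath's `N+M−1` carries a positive thermostat weight of the device. -/
theorem deviceWeight_pos_of_val_eq_last {i : Fin (N + M)} (hi : i.val = N + M - 1) : 0 < deviceWeight N M i := by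
  unfold deviceWeight OscillatorChain.bathWeight
  rw [if_pos hi]
  have h0 : 0 ≤ (if i.val = 0 then (1 : ℝ) else 0) := by split_ifs <;> norm_num
  have h2 : 0 ≤ (if i.val = N - 1 then (1 : ℝ) else 0) := by split_ifs <;> norm_num
  have h3 : 0 ≤ (if i.val = N then (1 : ℝ) else 0) := by split_ifs <;> norm_num
  linarith

/-- A site whose index is the near bath's `0` carries a positive thermostat weight of the device. -/
theorem deviceWeight_pos_of_val_eq_zero {i : Fin (N + M)} (hi : i.val = 0) : 0 < deviceWeight N M i := by
  unfold deviceWeight OscillatorChain.bathWeight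
  rw [if_pos hi]
  have h0 : 0 ≤ (if i.val = N + M - 1 then (1 : ℝ) else 0) := by split_ifs <;> norm_num
  have h2 : 0 ≤ (if i.val = N - 1 then (1 : ℝ) else 0) := by split_ifs <;> norm_num
  have h3 : 0 ≤ (if i.val = N then (1 : ℝ) else 0) := by split_ifs <;> norm_num
  linarith

/-- A `κ`-resolvent field of the terminal at site `s < N+M` in PAIR FORM:
`X_H g + γ S_B g = −((p_s² − T) − κ g)`, `B = deviceWeight N M`. -/
theorem deviceResolvent_pair_sq (κ : ℝ) {s : ℕ} (hs : s < N + M) {g : PhaseSpace (N + M) → ℝ}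
    (hpde : ∀ x, κ * g x - deviceGenerator (pinnedChain ω₂ lam β γ) N M (fun _ => T) g x = kin (N + M) s x - T)
    (x : PhaseSpace (N + M)) :
    1 * liouvilleOp (pinnedChain ω₂ lam β γ) (N + M) g x + γ * bathOp (N + M) (deviceWeight N M) T g x =
      -((x.2 ⟨s, hs⟩ ^ 2 - T) - κ * g x) := by
  have h := hpde x
  rw [deviceGenerator_eq, kin_eq_sq hs] at h
  have hγ' : (pinnedChain ω₂ lam β γ).γ = γ := rfl
  rw [hγ'] at h
  linarith

/-- Its momentum reversal is a BACKWARD resolvent pair: `−X_H (g∘R) + γ S_B (g∘R) = −((p_s² − T) − κ g∘R)`. -/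
theorem deviceResolvent_rev_pair_sq (κ : ℝ) {s : ℕ} (hs : s < N + M) {g : PhaseSpace (N + M) → ℝ}
    (hpde : ∀ x, κ * g x - deviceGenerator (pinnedChain ω₂ lam β γ) N M (fun _ => T) g x = kin (N + M) s x - T)
    (x : PhaseSpace (N + M)) :
    -1 * liouvilleOp (pinnedChain ω₂ lam β γ) (N + M) (rev g) x +
        γ * bathOp (N + M) (deviceWeight N M) T (rev g) x =
      -((x.2 ⟨s, hs⟩ ^ 2 - T) - κ * rev g x) := by
  have h := rev_pair (pinnedChain ω₂ lam β γ) (deviceWeight N M) T 1 γ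
    (k := fun y => (y.2 ⟨s, hs⟩ ^ 2 - T) - κ * g y) (deviceResolvent_pair_sq κ hs hpde) x
  rw [h, rev_apply, rev_apply]
  simp

/-- **A resolvent field has a square-integrable momentum gradient at every thermostatted site** (finite entropy
production at the device's baths; the landed energy estimate `Kubo.memLp_partialP` for the pair form). -/
theorem memLp_partialP_deviceResolvent (hω : 0 < ω₂) (hl : 0 ≤ lam) (hβ : 0 ≤ β) (hγ : 0 < γ) (hT : 0 < T)
    {κ : ℝ} {s : ℕ} (hs : s < N + M) {g : PhaseSpace (N + M) → ℝ}
    (hg : g ∈ deviceResolventFields ω₂ lam β γ T N M s κ) {j : Fin (N + M)} (hj : 0 < deviceWeight N M j) :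
    MemLp (partialP j g) 2 ((pinnedChain ω₂ lam β γ).gibbsMeasure (N + M) T) := by
  obtain ⟨hgC, hgL, hpde⟩ := hg
  have hk : MemLp (fun x : PhaseSpace (N + M) => (x.2 ⟨s, hs⟩ ^ 2 - T) - κ * g x) 2
      ((pinnedChain ω₂ lam β γ).gibbsMeasure (N + M) T) :=
    (memLp_kinetic hω hl hβ (N + M) hT ⟨s, hs⟩).sub (hgL.const_mul κ)
  exact memLp_partialP hω hl hβ γ (N + M) hT (deviceWeight N M) (deviceWeight_nonneg N M) 1 hγ hgC hgL hk
    (deviceResolvent_pair_sq κ hs hpde) hj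

end Resolvent

/-! ## §2 The bypass in gradient form -/

section Gradient

variable {ω₂ lam β γ T : ℝ} {N M : ℕ}

/-- `K₀₃ = −(γ²/T²)⟨g_0, p_{L−1}² − T⟩` (unfolding the skeleton's `kuboMatrix` at `(0, 3)`; `L = N + M`). -/
theorem kuboMatrix_zero_three_eq (ω₂ lam β γ T : ℝ) (N M : ℕ) (g : Fin 4 → PhaseSpace (N + M) → ℝ) :
    kuboMatrix ω₂ lam β γ T N M g 0 3 = -(γ ^ 2 / T ^ 2 *
      ∫ x, g 0 x * (kin (N + M) (N + M - 1) x - T) ∂((pinnedChain ω₂ lam β γ).gibbsMeasure (N + M) T)) := by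
  simp [kuboMatrix, termSite_three]

/-- `K₃₀ = −(γ²/T²)⟨g_3, p_0² − T⟩` (unfolding the skeleton's `kuboMatrix` at `(3, 0)`). -/
theorem kuboMatrix_three_zero_eq (ω₂ lam β γ T : ℝ) (N M : ℕ) (g : Fin 4 → PhaseSpace (N + M) → ℝ) :
    kuboMatrix ω₂ lam β γ T N M g 3 0 = -(γ ^ 2 / T ^ 2 *
      ∫ x, g 3 x * (kin (N + M) 0 x - T) ∂((pinnedChain ω₂ lam β γ).gibbsMeasure (N + M) T)) := by
  simp [kuboMatrix, termSite_zero]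

/-- **The bypass in GRADIENT FORM.** For a `κ`-resolvent field `g_0` of bath `0` (`N, M ≥ 1`):
`−K₀₃ = (γ²/T)·⟨∂_{p_{L−1}} g_0, p_{L−1}⟩_{μ_T}` — Gaussian integration by parts in the far bath momentum; the
momentum gradient is square integrable because site `L−1` is thermostatted. -/
theorem bypass_eq_farGradient (hω : 0 < ω₂) (hl : 0 ≤ lam) (hβ : 0 ≤ β) (hγ : 0 < γ) (hT : 0 < T)
    (hL : 1 ≤ N + M) {κ : ℝ} (g : Fin 4 → PhaseSpace (N + M) → ℝ)
    (hg₀ : g 0 ∈ deviceResolventFields ω₂ lam β γ T N M 0 κ) :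
    -(kuboMatrix ω₂ lam β γ T N M g 0 3) = γ ^ 2 / T *
      ∫ x, partialP ⟨N + M - 1, by omega⟩ (g 0) x * x.2 ⟨N + M - 1, by omega⟩
        ∂((pinnedChain ω₂ lam β γ).gibbsMeasure (N + M) T) := by
  have hdg := memLp_partialP_deviceResolvent hω hl hβ hγ hT (show 0 < N + M by omega) hg₀ (deviceWeight_pos_of_val_eq_last (i := ⟨N + M - 1, by omega⟩) rfl)
  obtain ⟨hgC, hgL, -⟩ := hg₀
  rw [kuboMatrix_zero_three_eq, neg_neg]
  simp_rw [kin_eq_sq (show N + M - 1 < N + M by omega)]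
  rw [integral_mul_sq_sub_gibbsMeasure hω hl hβ γ (N + M) hT ⟨N + M - 1, by omega⟩ (hgC.differentiable two_ne_zero)
    hgL hdg]
  have hT0 : T ≠ 0 := hT.ne'
  field_simp

/-- **The bypass is controlled by the far-gradient NORM**: `−K₀₃ ≤ (γ²/T²)·T√T·‖∂_{p_{L−1}} g_0‖_{L²(μ_T)}`
(`= γ² T^{-1/2}‖∂_{p_{L−1}} g_0‖`; Cauchy–Schwarz and equipartition `⟨p_{L−1}²⟩_{μ_T} = T`). -/
theorem bypass_le_farGradientNorm (hω : 0 < ω₂) (hl : 0 ≤ lam) (hβ : 0 ≤ β) (hγ : 0 < γ) (hT : 0 < T)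
    (hL : 1 ≤ N + M) {κ : ℝ} (g : Fin 4 → PhaseSpace (N + M) → ℝ)
    (hg₀ : g 0 ∈ deviceResolventFields ω₂ lam β γ T N M 0 κ) :
    -(kuboMatrix ω₂ lam β γ T N M g 0 3) ≤ γ ^ 2 / T ^ 2 * (T * Real.sqrt T *
      Real.sqrt (∫ x, partialP ⟨N + M - 1, by omega⟩ (g 0) x ^ 2 ∂((pinnedChain ω₂ lam β γ).gibbsMeasure (N + M) T))) := by
  have hdg := memLp_partialP_deviceResolvent hω hl hβ hγ hT (show 0 < N + M by omega) hg₀ (deviceWeight_pos_of_val_eq_last (i := ⟨N + M - 1, by omega⟩) rfl)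
  obtain ⟨hgC, hgL, -⟩ := hg₀
  rw [kuboMatrix_zero_three_eq, neg_neg]
  simp_rw [kin_eq_sq (show N + M - 1 < N + M by omega)]
  have h := abs_integral_mul_sq_sub_gibbsMeasure_le hω hl hβ γ (N + M) hT ⟨N + M - 1, by omega⟩
    (hgC.differentiable two_ne_zero) hgL hdg
  have hc : 0 ≤ γ ^ 2 / T ^ 2 := by positivity
  exact le_trans (mul_le_mul_of_nonneg_left (le_abs_self _) hc) (mul_le_mul_of_nonneg_left h hc)

/-- **Onsager symmetry of the resolvent Kubo matrix** (`N, M ≥ 2`, `κ ≥ 0`): `K_ab = K_ba` for every family of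
`κ`-resolvent fields of the four terminals (the symmetry clause of the landed `kubo_onsager_resolvent`). -/
theorem kuboMatrix_symm_resolvent (hω : 0 < ω₂) (hl : 0 ≤ lam) (hβ : 0 ≤ β) (hγ : 0 < γ) (hT : 0 < T)
    (hN : 2 ≤ N) (hM : 2 ≤ M) {κ : ℝ} (hκ : 0 ≤ κ) (g : Fin 4 → PhaseSpace (N + M) → ℝ)
    (hg : ∀ a : Fin 4, g a ∈ deviceResolventFields ω₂ lam β γ T N M (termSite N M a) κ) (a b : Fin 4) :
    kuboMatrix ω₂ lam β γ T N M g a b = kuboMatrix ω₂ lam β γ T N M g b a := by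
  -- adapted from `stub_kuboDiagNonneg` (…StubKappaFrame): the resolvent family as a terminal frame
  have hN1 : 1 ≤ N := by omega
  have hM1 : 1 ≤ M := by omega
  set s := termFin N M hN1 hM1 with hs_def
  have hs : Function.Injective s := termFin_injective hN hM
  have hBw : deviceWeight N M = termWeight s := deviceWeight_eq_termWeight hN hM
  have hg2 : ∀ c, ContDiff ℝ 2 (g c) := fun c => (hg c).1
  have hgL : ∀ c, MemLp (g c) 2 ((pinnedChain ω₂ lam β γ).gibbsMeasure (N + M) T) := fun c => (hg c).2.1
  have hkin : ∀ (c : Fin 4) (x : PhaseSpace (N + M)), kin (N + M) (termSite N M c) x = x.2 (s c) ^ 2 :=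
    fun c x => kin_eq_sq (termSite_lt hN1 hM1 c) x
  have hpde : ∀ c x, (1 : ℝ) * liouvilleOp (pinnedChain ω₂ lam β γ) (N + M) (g c) x +
      γ * bathOp (N + M) (termWeight s) T (g c) x = -((x.2 (s c) ^ 2 - T) - κ * g c x) := by
    intro c x
    have e := (hg c).2.2 x
    have hγP : (pinnedChain ω₂ lam β γ).γ = γ := rfl
    rw [hkin c x, deviceGenerator_eq, hBw, hγP] at e
    linarith
  have hK : ∀ c d, kuboMatrix ω₂ lam β γ T N M g c d = (if c = d then γ else 0) -
      γ ^ 2 / T ^ 2 * ∫ x, g c x * (x.2 (s d) ^ 2 - T) ∂((pinnedChain ω₂ lam β γ).gibbsMeasure (N + M) T) := by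
    intro c d
    simp only [kuboMatrix, hkin d]
  obtain ⟨hsymm, -, -, -, -⟩ := kubo_onsager_resolvent hω hl hβ (N + M) hT s hs 1 hγ hκ hg2 hgL hpde
    (kuboMatrix ω₂ lam β γ T N M g) hK
  exact hsymm.apply b a

/-- **The bypass in the mirror gradient form** (`N, M ≥ 2`, `κ ≥ 0`): `−K₀₃ = −K₃₀ = (γ²/T)·⟨∂_{p_0} g_3, p_0⟩_{μ_T}` —
Onsager symmetry, then Gaussian integration by parts in the NEAR bath momentum against the far bath's field. -/
theorem bypass_eq_nearGradient (hω : 0 < ω₂) (hl : 0 ≤ lam) (hβ : 0 ≤ β) (hγ : 0 < γ) (hT : 0 < T)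
    (hN : 2 ≤ N) (hM : 2 ≤ M) {κ : ℝ} (hκ : 0 ≤ κ) (g : Fin 4 → PhaseSpace (N + M) → ℝ)
    (hg : ∀ a : Fin 4, g a ∈ deviceResolventFields ω₂ lam β γ T N M (termSite N M a) κ) :
    -(kuboMatrix ω₂ lam β γ T N M g 0 3) = γ ^ 2 / T *
      ∫ x, partialP ⟨0, by omega⟩ (g 3) x * x.2 ⟨0, by omega⟩ ∂((pinnedChain ω₂ lam β γ).gibbsMeasure (N + M) T) := by
  have hg₃ : g 3 ∈ deviceResolventFields ω₂ lam β γ T N M (N + M - 1) κ := hg 3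
  have hdg := memLp_partialP_deviceResolvent hω hl hβ hγ hT (show N + M - 1 < N + M by omega) hg₃
    (deviceWeight_pos_of_val_eq_zero (i := ⟨0, by omega⟩) rfl)
  obtain ⟨hgC, hgL, -⟩ := hg₃
  rw [kuboMatrix_symm_resolvent hω hl hβ hγ hT hN hM hκ g hg 0 3, kuboMatrix_three_zero_eq, neg_neg]
  simp_rw [kin_eq_sq (show 0 < N + M by omega)]
  rw [integral_mul_sq_sub_gibbsMeasure hω hl hβ γ (N + M) hT ⟨0, by omega⟩ (hgC.differentiable two_ne_zero) hgL hdg]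
  have hT0 : T ≠ 0 := hT.ne'
  field_simp

/-! ### The κ-defect has the same far gradient -/

/-- **A left-block observable does not change the far gradient**: for every `F : PhaseSpace N → ℝ` (no regularity)
`∂_{p_{L−1}}(g − F∘π_N) = ∂_{p_{L−1}} g` pointwise (`M ≥ 1`; the far momentum is not a left-block coordinate). -/
theorem partialP_last_sub_comp_restrictLeft (hM : 1 ≤ M) (g : PhaseSpace (N + M) → ℝ) (F : PhaseSpace N → ℝ)
    (x : PhaseSpace (N + M)) :
    partialP ⟨N + M - 1, by omega⟩
        (fun y : PhaseSpace (N + M) => g y - F (y.1 ∘ Fin.castAdd M, y.2 ∘ Fin.castAdd M)) x =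
      partialP ⟨N + M - 1, by omega⟩ g x := by
  unfold partialP
  have e : (fun t : ℝ => g ((x.1, Function.update x.2 ⟨N + M - 1, by omega⟩ t)) -
      F ((x.1, Function.update x.2 ⟨N + M - 1, by omega⟩ t).1 ∘ Fin.castAdd M,
        (x.1, Function.update x.2 ⟨N + M - 1, by omega⟩ t).2 ∘ Fin.castAdd M)) =
      fun t : ℝ => g ((x.1, Function.update x.2 ⟨N + M - 1, by omega⟩ t)) -
        F (x.1 ∘ Fin.castAdd M, x.2 ∘ Fin.castAdd M) := by
    funext t
    congr 2
    congr 1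
    funext j
    simp only [Function.comp_apply]
    rw [Function.update_of_ne]
    intro h
    have := congrArg Fin.val h
    simp at this
    omega
  rw [e, deriv_sub_const]

/-- **The bypass as the far gradient of ANY κ-defect** (`N, M ≥ 1`): for every left-block observable `F`,
`−K₀₃ = (γ²/T)·⟨∂_{p_{L−1}}(g_0 − F∘π_N), p_{L−1}⟩_{μ_T}`. With `F = g_N` a plain forward field of the bare `N`-chain,
`g_0 − g_N∘π_N` is the κ-defect, driven only through the junction (helper V of S1',
`…StubTerminationLocalityAux5.deviceResolvent_defect`; pair form `farDefect_pair` in part V, `…StubBypassBoundAux5`). -/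
theorem bypass_eq_defectGradient (hω : 0 < ω₂) (hl : 0 ≤ lam) (hβ : 0 ≤ β) (hγ : 0 < γ) (hT : 0 < T)
    (hN : 1 ≤ N) (hM : 1 ≤ M) {κ : ℝ} (g : Fin 4 → PhaseSpace (N + M) → ℝ)
    (hg₀ : g 0 ∈ deviceResolventFields ω₂ lam β γ T N M 0 κ) (F : PhaseSpace N → ℝ) :
    -(kuboMatrix ω₂ lam β γ T N M g 0 3) = γ ^ 2 / T *
      ∫ x, partialP ⟨N + M - 1, by omega⟩
          (fun y : PhaseSpace (N + M) => g 0 y - F (y.1 ∘ Fin.castAdd M, y.2 ∘ Fin.castAdd M)) x *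
        x.2 ⟨N + M - 1, by omega⟩ ∂((pinnedChain ω₂ lam β γ).gibbsMeasure (N + M) T) := by
  simp_rw [partialP_last_sub_comp_restrictLeft hM]
  exact bypass_eq_farGradient hω hl hβ hγ hT (by omega) g hg₀

end Gradient

/-! ## §3 Reduction of S2' to a far-gradient norm bound (sufficient) -/

section Reduction

/-- **Reduction of S2' to a far-gradient NORM bound** (sufficient; not known to be equivalent). If, `N`-uniformly
and eventually in `κ`, `(γ²/T²)·T√T·‖∂_{p_{L−1}} g_0‖_{L²(μ_T)} ≤ C₃ K₀₀ K₃₃` for every resolvent family, then the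
conclusion of `stub_bypassBound` holds with the same constant (`bypass_le_farGradientNorm`). -/
theorem helper_bypassBoundOfFarGradientNorm : ∀ (ω₂ lam β γ T : ℝ), 0 < ω₂ → 0 < lam → 0 < β → 0 < γ → 0 < T → ∀ (C₃ : ℝ), (∀ (N M : ℕ) (hN : 2 ≤ N) (hM : 2 ≤ M), ∃ κ₃ : ℝ, 0 < κ₃ ∧ ∀ κ : ℝ, 0 < κ → κ ≤ κ₃ → ∀ (g : Fin 4 → PhaseSpace (N + M) → ℝ), (∀ a : Fin 4, g a ∈ deviceResolventFields ω₂ lam β γ T N M (termSite N M a) κ) → γ ^ 2 / T ^ 2 * (T * Real.sqrt T * Real.sqrt (∫ x, partialP ⟨N + M - 1, by omega⟩ (g 0) x ^ 2 ∂((pinnedChain ω₂ lam β γ).gibbsMeasure (N + M) T))) ≤ C₃ * kuboMatrix ω₂ lam β γ T N M g 0 0 * kuboMatrix ω₂ lam β γ T N M g 3 3) → ∀ N M : ℕ, 2 ≤ N → 2 ≤ M → ∃ κ₃ : ℝ, 0 < κ₃ ∧ ∀ κ : ℝ, 0 < κ → κ ≤ κ₃ → ∀ g : Fin 4 → PhaseSpace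 (N + M) → ℝ, (∀ a : Fin 4, g a ∈ deviceResolventFields ω₂ lam β γ T N M (termSite N M a) κ) → -(kuboMatrix ω₂ lam β γ T N M g 0 3) ≤ C₃ * kuboMatrix ω₂ lam β γ T N M g 0 0 * kuboMatrix ω₂ lam β γ T N M g 3 3 := by
  intro ω₂ lam β γ T hω hlam hβ hγ hT C₃ hGB N M hN hM
  obtain ⟨κ₃, hκ₃, h⟩ := hGB N M hN hM
  refine ⟨κ₃, hκ₃, fun κ hκ hκle g hg => ?_⟩
  exact le_trans (bypass_le_farGradientNorm hω hlam.le hβ.le hγ hT (by omega) g (hg 0)) (h κ hκ hκle g hg)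

end Reduction

end Summit.AtomisticToContinuum.FouriersLaw.Cruxes.SuperadditiveResistance.FloatingProbeBypassLaplacian

end
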